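import Mathlib
import HarnessLib
import Summits.Ventures.LatticeQCDFlow.Exactness.HaarSU2Gaussian
import Summits.Ventures.LatticeQCDFlow.Exactness.SphereKickJacobian
import Literature.MathematicalPhysics.QuantumFieldTheory.WilsonFlow

/-!
# The SU(2) Wilson-flow LO sub-step is a group translation by a closed-form exponential

`SU2WilsonFlowLOSubstep.lean` / `SU2WilsonFlowLOMember.lean` type the engine's zero-parameter
member on the SU(2) rung as the masked link update
`U ↦ gaussUnit (geodesicKick ε J (vecQuat U))`, written in the quaternion coordinates
`vecQuat : M₂(ℂ) → ℝ⁴`, `gaussUnit : ℝ⁴ → SU(2)` of `HaarSU2Gaussian.lean` and the sphere kick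
`geodesicKick` of `SphereGeodesicKick.lean` (E–S eq. (17)).  That form is what the Haar-Jacobian
certificate needs; this file records, def-free, that it IS the familiar Lie-group Euler step

  `U' = U · 𝓔(ε, X)`,   `X = Im (U⁻¹ ⋆ J) ∈ ℝ³ ≅ su(2)`,
  `𝓔(ε, X) = gaussUnit (cos (ε‖X‖), ε sinc (ε‖X‖) X)` — the closed-form unit quaternion
  `cos (ε‖X‖) 𝟙 + sin (ε‖X‖) X̂` (the same closed form the engine's momentum drift uses),

where `U⁻¹ ⋆ J = lmulIso U⁻¹ J` is left quaternion multiplication (`HaarSU2Gaussian.lmulIso`).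

* `geodesicKick_vecQuat_eq_lmulIso` — transport to the identity: by the covariance of the kick
  under the linear isometry `lmulIso U` (`geodesicKick_map`),
  `geodesicKick c J (vecQuat U) = lmulIso U (geodesicKick c (lmulIso U⁻¹ J) (vecQuat 1))`.
* `tangentKick_vecQuat_one`, `geodesicKick_vecQuat_one` — at the identity the tangential part of
  `j` is its imaginary part `(0, j₁, j₂, j₃)` and the kick is the closed-form exponential vector
  `(cos (c r), c sinc (c r) j₁, c sinc (c r) j₂, c sinc (c r) j₃)`, `r = √(j₁² + j₂² + j₃²)`.
* `gaussUnit_geodesicKick_vecQuat` — the link update is the right translation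
  `gaussUnit (geodesicKick c J (vecQuat U)) = U * gaussUnit (closed-form exponential of Im (lmulIso U⁻¹ J))`.
* `lmulIso_inv_sum_vecQuat` — the transported local field: for quaternion matrices `M s`,
  `lmulIso U⁻¹ (∑ s, vecQuat (M s)) = ∑ s, vecQuat (U⁻¹ * M s)`; with the staple field of
  `SU2WilsonFlowLOSubstep.lean` (`M = A_ν⁻¹, B_ν⁻¹`, `A_ν, B_ν` the two staples through the link in
  the `(μ,ν)` plane) each `U⁻¹ A_ν⁻¹ = (A_ν U)⁻¹` is the inverse of the plaquette holonomy through the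
  link, so `X` is minus the sum of the imaginary (traceless anti-Hermitian) parts of the `2(d−1)`
  plaquette holonomies containing the link — the steepest-descent direction of the Wilson
  plaquette action, i.e. the Euler step of Lüscher's Wilson flow `∂ₜU = −(∂S)U` at leading order.

NOT CLAIMED: the identification of the closed-form unit quaternion with `NormedSpace.exp` of the
`su(2)` matrix (a power-series statement not needed by the engine, which evaluates the closed form);
the normalisation of `ε` against Lüscher's flow time (`ε = β·δt/…` is a convention of the driver);
SU(N ≥ 3).

HONEST FRAMING: exact (Metropolis-corrected) sampling algorithms for lattice gauge theory; figures of
merit are autocorrelation/cost numbers at stated couplings and volumes; no continuum-physics claim.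
-/

namespace Summit.Ventures.LatticeQCDFlow.Exactness

open Real InnerProductGeometry WithLp
open Literature.MathematicalPhysics.QuantumFieldTheory
open scoped Matrix

noncomputable section

/-! ## Transport to the identity -/

/-- Left multiplication by `U` sends the identity's coordinates to `U`'s coordinates:
`lmulIso U (vecQuat 1) = vecQuat U`. -/
theorem lmulIso_vecQuat_one (U : Matrix.specialUnitaryGroup (Fin 2) ℂ) :
    lmulIso U (vecQuat (1 : Matrix (Fin 2) (Fin 2) ℂ)) = vecQuat (U : Matrix (Fin 2) (Fin 2) ℂ) := by
  rw [lmulIso_apply, quatVec_vecQuat IsQuat.one, Matrix.mul_one]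

/-- `lmulIso U` undoes `lmulIso U⁻¹`. -/
theorem lmulIso_lmulIso_inv (U : Matrix.specialUnitaryGroup (Fin 2) ℂ) (J : R4) :
    lmulIso U (lmulIso U⁻¹ J) = J := by
  have hq : quatVec (lmulIso U (lmulIso U⁻¹ J)) = quatVec J := by
    rw [quatVec_lmulIso, quatVec_lmulIso, ← Matrix.mul_assoc, ← WilsonFlow.coe_mul_SU,
      mul_inv_cancel, OneMemClass.coe_one, Matrix.one_mul]
  have h := congrArg vecQuat hq
  rwa [vecQuat_quatVec, vecQuat_quatVec] at h

/-- `lmulIso U⁻¹` undoes `lmulIso U`. -/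
theorem lmulIso_inv_lmulIso (U : Matrix.specialUnitaryGroup (Fin 2) ℂ) (J : R4) :
    lmulIso U⁻¹ (lmulIso U J) = J := by
  have h := lmulIso_lmulIso_inv U⁻¹ J
  rwa [inv_inv] at h

/-- **Transport to the identity.**  The kick at the link `U` driven by the local field `J` is the
left translate by `U` of the kick at the identity driven by the transported field `U⁻¹ ⋆ J`:
`geodesicKick c J (vecQuat U) = lmulIso U (geodesicKick c (lmulIso U⁻¹ J) (vecQuat 1))`
(covariance of E–S eq. (17) under the isometry `lmulIso U` of `ℝ⁴`). -/
theorem geodesicKick_vecQuat_eq_lmulIso (U : Matrix.specialUnitaryGroup (Fin 2) ℂ) (c : ℝ) (J : R4) :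
    geodesicKick c J (vecQuat (U : Matrix (Fin 2) (Fin 2) ℂ)) =
      lmulIso U (geodesicKick c (lmulIso U⁻¹ J) (vecQuat (1 : Matrix (Fin 2) (Fin 2) ℂ))) := by
  have h := geodesicKick_map (lmulIso U).toLinearIsometry c (lmulIso U⁻¹ J)
    (vecQuat (1 : Matrix (Fin 2) (Fin 2) ℂ))
  simp only [LinearIsometryEquiv.coe_toLinearIsometry] at h
  rw [lmulIso_lmulIso_inv, lmulIso_vecQuat_one] at h
  exact h

/-! ## The kick at the identity is the closed-form exponential -/

/-- The identity matrix has coordinates `(1, 0, 0, 0)`. -/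
theorem vecQuat_one : vecQuat (1 : Matrix (Fin 2) (Fin 2) ℂ) = EuclideanSpace.single 0 1 := by
  ext i
  fin_cases i <;> simp

/-- At the identity the tangential part of `j` is its imaginary part:
`tangentKick j (vecQuat 1) = (0, j₁, j₂, j₃)`. -/
theorem tangentKick_vecQuat_one (j : R4) :
    tangentKick j (vecQuat (1 : Matrix (Fin 2) (Fin 2) ℂ)) = toLp 2 ![0, j 1, j 2, j 3] := by
  rw [tangentKick, vecQuat_one, EuclideanSpace.inner_single_right]
  ext i
  fin_cases i <;> simp

/-- The length of the imaginary part: `‖(0, j₁, j₂, j₃)‖ = √(j₁² + j₂² + j₃²)`. -/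
theorem norm_imVec (j : R4) :
    ‖(toLp 2 ![0, j 1, j 2, j 3] : R4)‖ = √(j 1 ^ 2 + j 2 ^ 2 + j 3 ^ 2) := by
  rw [EuclideanSpace.norm_eq, Fin.sum_univ_four]
  congr 1
  simp [sq_abs]

/-- **The kick at the identity is the closed-form exponential**: with `r = √(j₁² + j₂² + j₃²)`,
`geodesicKick c j (vecQuat 1) = (cos (c r), c sinc (c r) j₁, c sinc (c r) j₂, c sinc (c r) j₃)` —
the unit quaternion `cos (c r) 𝟙 + sin (c r) ĵ` of the imaginary part `ĵ = (j₁, j₂, j₃)/r`, i.e.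
the `SU(2)` exponential of the `su(2)` element with coordinates `c (j₁, j₂, j₃)` in closed form
(at `r = 0` both sides are the identity). -/
theorem geodesicKick_vecQuat_one (c : ℝ) (j : R4) :
    geodesicKick c j (vecQuat (1 : Matrix (Fin 2) (Fin 2) ℂ)) =
      toLp 2 ![Real.cos (c * √(j 1 ^ 2 + j 2 ^ 2 + j 3 ^ 2)),
        c * sinc (c * √(j 1 ^ 2 + j 2 ^ 2 + j 3 ^ 2)) * j 1,
        c * sinc (c * √(j 1 ^ 2 + j 2 ^ 2 + j 3 ^ 2)) * j 2,
        c * sinc (c * √(j 1 ^ 2 + j 2 ^ 2 + j 3 ^ 2)) * j 3] := by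
  rw [geodesicKick, sin_div_norm_smul_eq_sinc, tangentKick_vecQuat_one, norm_imVec, vecQuat_one]
  ext i
  fin_cases i <;> simp

/-! ## The link update is a right translation by the exponential -/

/-- The closed-form exponential vector is a unit vector (in particular non-zero). -/
theorem norm_geodesicKick_vecQuat_one (c : ℝ) (j : R4) :
    ‖geodesicKick c j (vecQuat (1 : Matrix (Fin 2) (Fin 2) ℂ))‖ = 1 :=
  norm_geodesicKick c j (by rw [vecQuat_one]; simp)

/-- **The SU(2) LO sub-step is the Lie–Euler step `U' = U · 𝓔(c, Im (U⁻¹ ⋆ J))`.**  For every link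
value `U ∈ SU(2)`, step constant `c` and local field `J ∈ ℝ⁴`, writing `j = lmulIso U⁻¹ J` for the
transported field and `r = √(j₁² + j₂² + j₃²)` for the length of its imaginary part,
`gaussUnit (geodesicKick c J (vecQuat U)) = U * gaussUnit (cos (c r), c sinc (c r) j₁, c sinc (c r) j₂, c sinc (c r) j₃)`:
the new link is the old link right-multiplied by the closed-form exponential of the `su(2)`
element `c · Im j`. -/
theorem gaussUnit_geodesicKick_vecQuat (U : Matrix.specialUnitaryGroup (Fin 2) ℂ) (c : ℝ) (J : R4) :
    gaussUnit (geodesicKick c J (vecQuat (U : Matrix (Fin 2) (Fin 2) ℂ))) =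
      U * gaussUnit (toLp 2
        ![Real.cos (c * √((lmulIso U⁻¹ J) 1 ^ 2 + (lmulIso U⁻¹ J) 2 ^ 2 + (lmulIso U⁻¹ J) 3 ^ 2)),
          c * sinc (c * √((lmulIso U⁻¹ J) 1 ^ 2 + (lmulIso U⁻¹ J) 2 ^ 2 + (lmulIso U⁻¹ J) 3 ^ 2)) *
            (lmulIso U⁻¹ J) 1,
          c * sinc (c * √((lmulIso U⁻¹ J) 1 ^ 2 + (lmulIso U⁻¹ J) 2 ^ 2 + (lmulIso U⁻¹ J) 3 ^ 2)) *
            (lmulIso U⁻¹ J) 2,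
          c * sinc (c * √((lmulIso U⁻¹ J) 1 ^ 2 + (lmulIso U⁻¹ J) 2 ^ 2 + (lmulIso U⁻¹ J) 3 ^ 2)) *
            (lmulIso U⁻¹ J) 3]) := by
  rw [← geodesicKick_vecQuat_one, geodesicKick_vecQuat_eq_lmulIso]
  refine gaussUnit_lmul U ?_
  intro h0
  have h1 := norm_geodesicKick_vecQuat_one c (lmulIso U⁻¹ J)
  rw [h0, norm_zero] at h1
  exact zero_ne_one h1

/-! ## The transported local field is a sum of plaquette holonomies through the link -/

/-- **Transport of a staple-type field.**  For quaternion matrices `M s` (e.g. inverses of SU(2)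
staples), `lmulIso U⁻¹ (∑ s, vecQuat (M s)) = ∑ s, vecQuat (U⁻¹ * M s)`: transporting the local
field to the identity multiplies every staple by `U⁻¹` on the left.  For the LO Wilson-flow field
of `SU2WilsonFlowLOSubstep.lean` (`M = A_ν⁻¹` and `B_ν⁻¹` over `ν ≠ μ`), `U⁻¹ A_ν⁻¹ = (A_ν U)⁻¹`
is the inverse of the holonomy of the plaquette through the link in the `(μ, ν)` plane, so the
exponent `Im (U⁻¹ ⋆ J)` of `gaussUnit_geodesicKick_vecQuat` is minus the sum of the imaginary parts
of the `2(d−1)` plaquette holonomies containing the link. -/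
theorem lmulIso_inv_sum_vecQuat {ι : Type*} (s : Finset ι) (U : Matrix.specialUnitaryGroup (Fin 2) ℂ)
    {M : ι → Matrix (Fin 2) (Fin 2) ℂ} (hM : ∀ i ∈ s, IsQuat (M i)) :
    lmulIso U⁻¹ (∑ i ∈ s, vecQuat (M i)) =
      ∑ i ∈ s, vecQuat (((U⁻¹ : Matrix.specialUnitaryGroup (Fin 2) ℂ) : Matrix (Fin 2) (Fin 2) ℂ) * M i) := by
  rw [map_sum]
  refine Finset.sum_congr rfl fun i hi => ?_
  rw [lmulIso_apply, quatVec_vecQuat (hM i hi)]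

/-- The staple case: for `A ∈ SU(2)`, `U⁻¹ * A⁻¹ = (A * U)⁻¹` as matrices — the transported
inverse staple is the inverse of the plaquette holonomy `A U` through the link. -/
theorem coe_inv_mul_coe_inv (U A : Matrix.specialUnitaryGroup (Fin 2) ℂ) :
    ((U⁻¹ : Matrix.specialUnitaryGroup (Fin 2) ℂ) : Matrix (Fin 2) (Fin 2) ℂ) *
        ((A⁻¹ : Matrix.specialUnitaryGroup (Fin 2) ℂ) : Matrix (Fin 2) (Fin 2) ℂ) =
      (((A * U)⁻¹ : Matrix.specialUnitaryGroup (Fin 2) ℂ) : Matrix (Fin 2) (Fin 2) ℂ) := by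
  rw [mul_inv_rev, WilsonFlow.coe_mul_SU]

/-- **Imaginary part of an inverse.**  For `P ∈ SU(2)` the coordinates of `P⁻¹` are those of `P`
with the imaginary part negated: `vecQuat P⁻¹ = (p₀, −p₁, −p₂, −p₃)` — so "minus the imaginary part
of the inverse plaquette holonomy" is "the imaginary part of the plaquette holonomy". -/
theorem vecQuat_coe_inv (P : Matrix.specialUnitaryGroup (Fin 2) ℂ) :
    vecQuat (((P⁻¹ : Matrix.specialUnitaryGroup (Fin 2) ℂ) : Matrix (Fin 2) (Fin 2) ℂ)) =
      toLp 2 ![vecQuat (P : Matrix (Fin 2) (Fin 2) ℂ) 0, -vecQuat (P : Matrix (Fin 2) (Fin 2) ℂ) 1,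
        -vecQuat (P : Matrix (Fin 2) (Fin 2) ℂ) 2, -vecQuat (P : Matrix (Fin 2) (Fin 2) ℂ) 3] := by
  have hP := IsQuat.of_mem_specialUnitaryGroup P.2
  rw [WilsonFlow.coe_inv_SU]
  ext i
  fin_cases i <;> simp [Matrix.conjTranspose_apply, hP.offdiag]

end

end Summit.Ventures.LatticeQCDFlow.Exactness
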